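import Summits.NavierStokesRegularity.NavierStokesRegularity.Theses.HardyPointSink
import Literature.Analysis.FluidPDE.LocalTypeILiouville
import Literature.Analysis.FluidPDE.KNSSAxisymmetricNoSwirlHolds

/-!
# Route HardyPointSink — crux `NoHardyTypeIAncient` (stmt-NavierStokesRegularity-7980), line `birth`:
# certificate — axisymmetric swirl-free witnesses are excluded

Summit-side proof file (certificate sub-goal of the registered skeleton
`Cruxes/NoHardyTypeIAncient/Lines/birth.lean`, lead c4). The crux
`HardyPointSink.NoHardyTypeIAncient` says that no triple `(u, p, G)` is a Hardy-bounded Type-I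
bounded ancient mild solution of Navier–Stokes which is not a.e. zero. This file proves it for the
subclass of witnesses whose slices are **axisymmetric without swirl**: by KNSS 2009, Thm 5.2 in the
tree's duality-form class (`knss_axisymmetric_no_swirl'_holds`, a tree THEOREM) every slice of such
a `u` is a.e. constant, and a field with `𝐈 < ∞` which is not a.e. zero on the slab is not
slice-wise a.e. constant (`not_ae_slice_const_of_abTypeIBound`, Albritton–Barker 2019 §1). Neither
the Hardy bound nor the suitability clause is used.

## References

* G. Koch, N. Nadirashvili, G. Seregin, V. Šverák, Acta Math. 203 (2009), Thm 5.2.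
* D. Albritton, T. Barker, J. Math. Fluid Mech. 21 (2019) no. 43 = arXiv:1811.00502, §1.
-/

noncomputable section

set_option linter.dupNamespace false

open MeasureTheory Set Function Filter TopologicalSpace
open scoped ENNReal NNReal Topology

namespace Summit.NavierStokesRegularity.NavierStokesRegularity.Theorems

open Summit.NavierStokesRegularity.NavierStokesRegularity.Theses.HardyPointSink

/-- **Certificate: axisymmetric swirl-free witnesses of the crux class are excluded.** No triple
`(u, p, G)` with measurable slices, `u` a bounded ancient mild solution (`ν = 1`, duality form),
`G` a weak spatial gradient of `u` on the slab `(−∞, 0) × ℝ³`, `u` not a.e. zero there and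
`𝐈(ℝ³ × ℝ₋) = typeIBound (Iio 0 ×ˢ univ) u p G < ∞`, has axisymmetric swirl-free slices at every
`t < 0`: KNSS 2009 Thm 5.2 (`knss_axisymmetric_no_swirl'_holds`) makes every slice a.e. constant,
contradicting `not_ae_slice_const_of_abTypeIBound`.
[cite: KochNadirashviliSereginSverak2009, Thm 5.2 (arXiv:0709.3599 pp. 9–10)] -/
theorem hardyPointSink_cert_axisymNoSwirl :
    ∀ (u : ℝ → EuclideanSpace ℝ (Fin 3) → EuclideanSpace ℝ (Fin 3))
      (p : ℝ → EuclideanSpace ℝ (Fin 3) → ℝ)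
      (G : ℝ → EuclideanSpace ℝ (Fin 3) → EuclideanSpace ℝ (Fin 3) →L[ℝ] EuclideanSpace ℝ (Fin 3)),
      (∀ t < 0, AEStronglyMeasurable (u t) volume) →
      Literature.Analysis.FluidPDE.IsBoundedAncientMildSolution 1 u →
      Literature.Analysis.FluidPDE.HasWeakSpatialGradientOn
        (Literature.Analysis.FluidPDE.slab (EuclideanSpace ℝ (Fin 3)) (Iio 0) isOpen_Iio) u G →
      ¬ (uncurry u =ᵐ[volume.restrict
        (Iio (0 : ℝ) ×ˢ (univ : Set (EuclideanSpace ℝ (Fin 3))))] 0) →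
      Literature.Analysis.FluidPDE.typeIBound
        (Iio (0 : ℝ) ×ˢ (univ : Set (EuclideanSpace ℝ (Fin 3)))) u p G < ⊤ →
      (∀ t < 0, Literature.Analysis.FluidPDE.IsAxisymmetric (u t)) →
      (∀ t < 0, Literature.Analysis.FluidPDE.HasNoSwirl (u t)) → False := by
  intro u p G hmeas hu hG hne hI haxi hsw
  have hjoint : AEStronglyMeasurable (uncurry u)
      (volume.restrict (Iio (0 : ℝ) ×ˢ (univ : Set (EuclideanSpace ℝ (Fin 3))))) :=
    hG.locallyIntegrableOn.aestronglyMeasurable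
  refine Literature.Analysis.FluidPDE.not_ae_slice_const_of_abTypeIBound hjoint hne hI ?_
  filter_upwards [ae_restrict_mem measurableSet_Iio] with t ht
  exact Literature.Analysis.FluidPDE.knss_axisymmetric_no_swirl'_holds hu hmeas haxi hsw t ht

/-- **The crux restricted to axisymmetric swirl-free witnesses holds** (restatement of
`hardyPointSink_cert_axisymNoSwirl` in the shape of `HardyPointSink.NoHardyTypeIAncient`: its
negand with the two symmetry clauses added). [cite: KochNadirashviliSereginSverak2009, Thm 5.2 (arXiv:0709.3599 pp. 9–10)] -/
theorem hardyPointSink_noHardyTypeIAncient_axisymNoSwirl :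
    ¬ ∃ (u : ℝ → EuclideanSpace ℝ (Fin 3) → EuclideanSpace ℝ (Fin 3))
        (p : ℝ → EuclideanSpace ℝ (Fin 3) → ℝ)
        (G : ℝ → EuclideanSpace ℝ (Fin 3) → EuclideanSpace ℝ (Fin 3) →L[ℝ] EuclideanSpace ℝ (Fin 3)),
      (∀ t < 0, AEStronglyMeasurable (u t) volume) ∧
      Literature.Analysis.FluidPDE.IsBoundedAncientMildSolution 1 u ∧
      Literature.Analysis.FluidPDE.IsSuitableWeakSolutionOn
        (Literature.Analysis.FluidPDE.slab (EuclideanSpace ℝ (Fin 3)) (Iio 0) isOpen_Iio) 1 0 u p ∧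
      Literature.Analysis.FluidPDE.HasWeakSpatialGradientOn
        (Literature.Analysis.FluidPDE.slab (EuclideanSpace ℝ (Fin 3)) (Iio 0) isOpen_Iio) u G ∧
      ¬ (uncurry u =ᵐ[volume.restrict
        (Iio (0 : ℝ) ×ˢ (univ : Set (EuclideanSpace ℝ (Fin 3))))] 0) ∧
      Literature.Analysis.FluidPDE.typeIBound
        (Iio (0 : ℝ) ×ˢ (univ : Set (EuclideanSpace ℝ (Fin 3)))) u p G < ⊤ ∧
      (∃ K : ℝ≥0, ∀ x₀ : EuclideanSpace ℝ (Fin 3), ∀ᵐ t ∂(volume.restrict (Iio (0 : ℝ))),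
        ∫⁻ x, ‖u t x‖ₑ ^ 2 / ‖x - x₀‖ₑ ≤ K) ∧
      (∀ t < 0, Literature.Analysis.FluidPDE.IsAxisymmetric (u t)) ∧
      (∀ t < 0, Literature.Analysis.FluidPDE.HasNoSwirl (u t)) := by
  rintro ⟨u, p, G, hmeas, hu, -, hG, hne, hI, -, haxi, hsw⟩
  exact hardyPointSink_cert_axisymNoSwirl u p G hmeas hu hG hne hI haxi hsw

end Summit.NavierStokesRegularity.NavierStokesRegularity.Theorems

end
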